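import Literature.MathematicalPhysics.QuantumFieldTheory.Balaban1983to89.B8Ineq159TopCubeTowerReads
import Literature.MathematicalPhysics.QuantumFieldTheory.Balaban1983to89.B8IdxB8SubDCubeFamDictionary
import Literature.MathematicalPhysics.QuantumFieldTheory.Balaban1983to89.B15LatticeCubeTorus

/-!
# `Balaban1983to89.B8Ineq159PeriodizedTowerReads` — [Balaban1985RegularSpaces] (1.131) p. 99, (1.5) p. 77, (1.31) p. 82, (1.38) p. 82, p. 77 («we admit
# the case when some domains Ω_j are equal to T_η»): the DICTIONARY between the PERIODISED Sect.-F tower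
# `Ωᴾ := periodize (fun _ ↦ P) (cubeFam true L a M ρ k)` — print's top-cube tower `(T_η, □₁, …, □_k)` of (1.131) with `□ ⊂ T_η` read on the universal
# cover `ℤᵈ` ([Balaban1984PropagatorsII] (2.1): the union of the deck translates) — and its TRANSLATE cube members `{□_j(a + q•v)}_{j=0}^{k}`, `Lᵏ·q = P`,
# under the SEPARATION `Lᵏ·M + 2·ρ·gs L k ≤ P` (the torus is at least as wide as `□₀`): translates, separation, print's level sets `Lam`, and the touching
# decomposition (file (A1); print's class (1.31) and the LANDAU TRANSFER (1.38) are file (A2) `B8Ineq159PeriodizedTowerClass`)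

statement-level skeleton of published theorems with citation tags; proofs where landed; nothing here is a claim about the
Yang–Mills mass gap

`[Balaban1985RegularSpaces]` ("B8", CMP **99** (1985) 75–102): p. 77 («Let us consider a sequence of domains Ω₀ ⊃ Ω₁ ⊃ … ⊃ Ω_k … we admit the case when
some domains Ω_j are equal to T_η»), (1.3)–(1.6) p. 77, (1.31) p. 82, (1.38) p. 82, (1.131) p. 99 («Λ′₀ = T ∖ □₁»), p. 98 («□_j ⊃ □_{j+1} and a distance between
boundaries of these cubes is equal to R₁M₁Lʲη», «for every j the cube □_j is a sum of the big blocks of the lattice T_{L^{−j}}»); [4] =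
`[Balaban1985BackgroundPropagators]` (3.19), (3.23)–(3.25) pp. 393–394; [B6] = `[Balaban1984PropagatorsII]` (2.1)–(2.3) p. 224; [B11] =
`[Balaban1985Variational]` (3) p. 278 (the level sets `B11Eq7Convention.Lam`).

CITATION HEADER (lean-in-tree rule).  Cell `pub-ymgap` (YM Track A, HUMAN RULING D-0062 ∕ D-0149), DAG node N05 = [B8], width seat `pub-ymgap-dag-n05-w3`
(g5), CLAIM-1 file (A1); director-ym №217 (1) «(β′-PERIODIC) is the road of record behind the [B8] display»; dag-n05-w2 g6 CLAIM-2 (the periodised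
Sect.-F tower is a `P`-periodic (1.5)-member).  WHY.  This seat's lineage proved the curved (1.59) per cube member `{□_j}` ((U) =
`B8Ineq159CurvedCubeMemberUniform`, constants uniform in the POSITION `a`) and drew the b9-socket of Proposition 3's frame at the top-cube tower
`cubeFam true L a M ρ k` (`B8SockB9P3H2AtTopCubeTower`).  On the periodic road the tower is read on the torus: on the universal cover this is the union of
the translates of `(T, □₁(a), …, □_k(a))` by the period lattice `P·ℤᵈ`, i.e. — when `Lᵏ ∣ P`, `P = Lᵏ·q` — the towers over the translate centres
`a + q•v`, `v ∈ ℤᵈ`.  THIS FILE and its companion (A2) are the bookkeeping that lets `B8SockB9P3H2AtPeriodizedTower` run the top-cube proof TRANSLATE-WISE: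
when the torus is at least as wide as `□₀` (`Lᵏ·M + 2·ρ·gs L k ≤ P`, the width of `□₀` in sites) the translates of `□₀` are pairwise DISJOINT, so every
local question about `Ωᴾ` near `□₀(a + q•v)` is the same question about the single tower over `a + q•v`.

THE MATHEMATICS (kernel-checked).  §1 TRANSLATES: `x ∈ Ωᴾ_j ↔ ∃ v, x ∈ □_j(a + q•v)` (`1 ≤ j ≤ k`; `Ωᴾ₀ = ℤᵈ`; the translate towers lie in `Ωᴾ`; `Ωᴾ` is
nested).  §2 SEPARATION: a site of `□₀(a + q•v)` lies in no cube of any other translate; a site adjacent to `□₀(a + q•v)` from outside lies in NO translate's `□₁`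
(collar `ρ ≥ 1`); hence the ends of an off-`□₀` side of a plaquette touching `□₀(a + q•v)` lie in no `□₁`.  §3 PRINT'S LEVEL SETS of `Ωᴾ` ([B11] (3), which read
`Ω` at the block CORNER only): `Lam L Ωᴾ k 0 = (⋃_w □₁(a + q•w))ᶜ`; for the label of a block meeting `□₀(a + q•v)` membership in `Lam L Ωᴾ k j` (`1 ≤ j ≤ k`) is
membership in the single tower's `Lam L (cubeFam true L (a + q•v) …) k j = cubeLamS …` (block saturation of the cubes + §2).  §4 TOUCHING: a bond ∕ plaquette ∕
side (side-)touching `Ωᴾ_j`, `j ≥ 1`, (side-)touches some translate's `□_j`, and conversely.  The companion `B8Ineq159PeriodizedTowerClass` carries print's class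
(1.31) `towerBondsP` over `Ωᴾ` and the LANDAU TRANSFER (1.38); `B8SockB9P3H2AtPeriodizedTower` draws the socket.

HONEST SCOPE.  Lattice bookkeeping only: no estimate of [B8] ∕ [4] is proved here; nothing of Bałaban's asserted; no index ∕ pin ∕ door ∕ model of the
periodic road typed (dag-n05-w1 ∕ dag-n05-c ∕ dag-n05-w2's pens untouched; the periodiser is the TREE's `B15LatticeCubeTorus.periodize` at the constant
period vector); count-neutral; N05 NOT discharged; one finite `𝕋⁴` programme at fixed `ε`, Bałaban as printed; the YM mass gap (Clay) is NOT proved by any of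
this — R4 closes the conditional finite-`𝕋⁴` rung `BalabanLadder.UV` only; nothing continuum ∕ ℝ⁴ ∕ OS.  No `sorry`, no `def`, no `instance`, no `notation`.
Unit `pub-ymgap-dag-n05-w3` (g5), 2026-08-28.
-/

noncomputable section

namespace Literature.MathematicalPhysics.QuantumFieldTheory.Balaban1983to89.B8Ineq159PeriodizedTowerReads

open B7Prop1Explicit B7Prop2Explicit B7Prop1Local B7Eq78Linearization
open B8Ineq132 (covDerivFwd covDeriv BondTouches PlaqTouches Under)
open B8Eq140Level (SideTouches IsSide sideTouches_of_bondTouches)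
open B8Eq138LandauZd (IsLandau138 QT QprimeT covDivB covLap)
open B8Eq131CubesAdmissible (cubeFam cubeFam_true_zero cubeFam_false_zero cubeFam_false_of_le cubeFam_of_pos cubeFam_of_lt smul_mem_cube_iff
  smul_mem_cube_succ_iff)
open B8Eq131Cubes (cube sqLo sqHi inLo inHi bLo bHi gs cube_anti cube_eq cube_succ_subset one_le_gs)
open B8CubeMemberZd (cubeLamS cubeLam cubeLamS_top mem_cubeLam_zero_iff inBox_sq_of_mem_cubeLamS)
open B8Ineq159FlatCubeMemberPrinted (cubeLamBP cubeLamBP_box_subset_pred)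
open B8Ineq159FlatCubeMemberKernel (inBox_in_zero_iff blockMap_pow_smul_self)
open B8Ineq159FlatCubeMemberResidual (mem_cube_iff_inBox_blockMap mem_cube_succ_iff_inBox_blockMap)
open B8Ineq159CurvedCubeMemberShift (mem_cube_add_iff)
open B8Ineq159CurvedCubeMemberLocalTower (QprimeT_congr_fun)
open B8Eq191FlatLettersCubeMember (under_iff_blockMap_eq)
open B8IdxB8SubDRigidity (loK_eq_smul)
open B8IdxB8SubDCubeFamDictionary (lamK_cubeFam_top_pos lamK_cubeFam_top_zero)
open B8TowerBondsPrinted (towerBondsP)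
open B8Ineq159TopCubeTowerReads (near_mem_cube_zero add_e_mem_cube_zero covDivB_congr_fld covLap_congr_fld cubeLamBP_subset_towerBondsP_topCube_of_le)
open B15LatticeCubeTorus (periodize pmul periodize_univ subset_periodize periodize_empty)
open B8Thm2LogB (blockTop)
open Literature.MathematicalPhysics.QuantumLattice (blockMap)

-- `Site` alone would resolve to the torus sites of `Setup.lean`; re-export the `ℤ^d` sites of `B7Prop1Explicit`.
export B7Prop1Explicit (Site)

variable {d : ℕ}

/-! ## §1 The periodised Sect.-F tower and its translates -/

section Translates

/-- The deck translation at the constant period vector is the scalar translation `P•v`. [cite: Balaban1984PropagatorsII, (2.1) p.224] -/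
theorem pmul_const (P : ℕ) (v : Site d) : pmul (fun _ : Fin d => P) v = (P : ℤ) • v := by
  funext μ; simp [pmul, Pi.smul_apply]

/-- Membership in the periodisation at a constant period: `x ∈ periodize P D n ↔ ∃ v, x − P•v ∈ D n`. [cite: Balaban1984PropagatorsII, (2.1) p.224] -/
theorem mem_periodize_const_iff (P : ℕ) (D : ℕ → Set (Site d)) (n : ℕ) (x : Site d) :
    x ∈ periodize (fun _ : Fin d => P) D n ↔ ∃ v : Site d, x - (P : ℤ) • v ∈ D n := by
  simp only [periodize, Set.mem_setOf_eq, pmul_const]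

/-- **`Ωᴾ₀ = ℤᵈ`**: the top domain of the periodised top-cube tower is the whole lattice (print's `Ω₀ = T_η` read on the cover).
[cite: Balaban1985RegularSpaces, p.77 («Ω_j = T_η»), (1.131) p.99] -/
theorem periodize_cubeFam_true_zero (P L : ℕ) (a : Site d) (M ρ k : ℕ) :
    periodize (fun _ : Fin d => P) (cubeFam true L a M ρ k) 0 = Set.univ :=
  periodize_univ (cubeFam_true_zero L a M ρ k)

/-- Above the depth the periodised tower is empty (`Ω_j = ∅` for `j > k`). [cite: Balaban1985RegularSpaces, (1.3) p.77] -/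
theorem periodize_cubeFam_true_of_lt (P L : ℕ) (a : Site d) (M ρ : ℕ) {k j : ℕ} (hkj : k < j) :
    periodize (fun _ : Fin d => P) (cubeFam true L a M ρ k) j = ∅ :=
  periodize_empty (cubeFam_of_lt true L a M ρ hkj)

/-- The fine translation `P•v = Lᵏ•(q•v)` when `Lᵏ·q = P`. [cite: Balaban1985RegularSpaces, (1.3) p.77 (the lattices `T^{(j)}`)] -/
theorem period_smul_eq {L k : ℕ} {P : ℕ} {q : ℤ} (hq : (L : ℤ) ^ k * q = P) (v : Site d) :
    (P : ℤ) • v = ((L : ℤ) ^ k) • (q • v) := by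
  rw [← mul_smul, hq]

/-- ★ **THE PERIODISED TOWER IS THE UNION OF THE TRANSLATE TOWERS**: for `1 ≤ j ≤ k` and `Lᵏ·q = P`, `x ∈ Ωᴾ_j ↔ ∃ v, x ∈ □_j(a + q•v)` (the cube of
(1.131) over the translated centre). [cite: Balaban1985RegularSpaces, (1.131) p.99, p.77; Balaban1984PropagatorsII, (2.1) p.224] -/
theorem mem_periodize_cubeFam_true_iff {L : ℕ} (a : Site d) (M ρ : ℕ) {k j : ℕ} {P : ℕ} {q : ℤ} (hq : (L : ℤ) ^ k * q = P)
    (hj1 : 1 ≤ j) (hjk : j ≤ k) (x : Site d) :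
    x ∈ periodize (fun _ : Fin d => P) (cubeFam true L a M ρ k) j ↔ ∃ v : Site d, x ∈ cube L (a + q • v) M ρ k j := by
  rw [mem_periodize_const_iff]
  refine exists_congr fun v => ?_
  rw [cubeFam_of_pos true L a M ρ hj1 hjk, ← mem_cube_add_iff a (q • v) M ρ hjk (x - (P : ℤ) • v), period_smul_eq hq, sub_add_cancel]

/-- **Each translate cube lies in the periodised tower** (`1 ≤ j ≤ k`). [cite: Balaban1984PropagatorsII, (2.1) p.224; Balaban1985RegularSpaces, (1.131) p.99] -/
theorem cube_translate_subset_periodize {L : ℕ} (a : Site d) (M ρ : ℕ) {k j : ℕ} {P : ℕ} {q : ℤ} (hq : (L : ℤ) ^ k * q = P)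
    (hj1 : 1 ≤ j) (hjk : j ≤ k) (v : Site d) :
    cube L (a + q • v) M ρ k j ⊆ periodize (fun _ : Fin d => P) (cubeFam true L a M ρ k) j :=
  fun x hx => (mem_periodize_cubeFam_true_iff a M ρ hq hj1 hjk x).2 ⟨v, hx⟩

/-- **Each translate TOWER lies in the periodised tower**, level by level (level `0`: `ℤᵈ ⊆ ℤᵈ`; levels `> k`: `∅`). [cite: Balaban1984PropagatorsII, (2.1) p.224] -/
theorem cubeFam_translate_subset_periodize {L : ℕ} (a : Site d) (M ρ k : ℕ) {P : ℕ} {q : ℤ} (hq : (L : ℤ) ^ k * q = P)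
    (v : Site d) (j : ℕ) :
    cubeFam true L (a + q • v) M ρ k j ⊆ periodize (fun _ : Fin d => P) (cubeFam true L a M ρ k) j := by
  rcases Nat.eq_zero_or_pos j with rfl | hj
  · rw [periodize_cubeFam_true_zero]; exact Set.subset_univ _
  · by_cases hjk : j ≤ k
    · rw [cubeFam_of_pos true L _ M ρ hj hjk]; exact cube_translate_subset_periodize a M ρ hq hj hjk v
    · rw [cubeFam_of_lt true L _ M ρ (lt_of_not_ge hjk)]; exact Set.empty_subset _

/-- The periodised tower is NESTED ((1.3) survives periodisation: translate-wise `□_{j+1} ⊂ □_j`). [cite: Balaban1985RegularSpaces, (1.3) p.77, p.98 («□_j ⊃ □_{j+1}»)] -/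
theorem periodize_cubeFam_true_anti {L : ℕ} (a : Site d) (M ρ k : ℕ) {P : ℕ} {q : ℤ} (hq : (L : ℤ) ^ k * q = P) (j : ℕ) :
    periodize (fun _ : Fin d => P) (cubeFam true L a M ρ k) (j + 1) ⊆ periodize (fun _ : Fin d => P) (cubeFam true L a M ρ k) j := by
  rcases Nat.eq_zero_or_pos j with rfl | hj
  · rw [periodize_cubeFam_true_zero]; exact Set.subset_univ _
  · by_cases hjk : j + 1 ≤ k
    · intro x hx
      obtain ⟨v, hv⟩ := (mem_periodize_cubeFam_true_iff a M ρ hq (by omega) hjk x).1 hx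
      exact cube_translate_subset_periodize a M ρ hq hj (by omega) v (cube_succ_subset (by omega) hv)
    · rw [periodize_cubeFam_true_of_lt P L a M ρ (show k < j + 1 by omega)]; exact Set.empty_subset _

/-- `Ωᴾ_i ⊆ Ωᴾ_j` for `j ≤ i`. [cite: Balaban1985RegularSpaces, (1.3) p.77] -/
theorem periodize_cubeFam_true_anti' {L : ℕ} (a : Site d) (M ρ k : ℕ) {P : ℕ} {q : ℤ} (hq : (L : ℤ) ^ k * q = P) {j i : ℕ} (hji : j ≤ i) :
    periodize (fun _ : Fin d => P) (cubeFam true L a M ρ k) i ⊆ periodize (fun _ : Fin d => P) (cubeFam true L a M ρ k) j := by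
  induction hji with
  | refl => exact le_rfl
  | step _ ih => exact (periodize_cubeFam_true_anti a M ρ k hq _).trans ih

end Translates

/-! ## §2 Separation: the torus is at least as wide as `□₀` -/

section Separation

/-- `0 < P` under the separation (`□₀` has at least one site). [cite: Balaban1985RegularSpaces, p.98] -/
theorem period_pos {L M ρ k P : ℕ} (hρ : 1 ≤ ρ) (hP : L ^ k * M + 2 * (ρ * gs L k) ≤ P) : 0 < P := by
  have h1 : 1 ≤ ρ * gs L k := Nat.one_le_iff_ne_zero.2 (Nat.mul_ne_zero (by omega) (Nat.one_le_iff_ne_zero.1 (one_le_gs L k)))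
  omega

/-- ★ **THE TRANSLATES OF `□₀` ARE PAIRWISE DISJOINT** when the period is at least the width `Lᵏ·M + 2·ρ·gs L k` of `□₀`: a common site forces `v = w`.
[cite: Balaban1985RegularSpaces, p.98 (display before (1.128): the margins of `□₀`), (1.131) p.99; Balaban1984PropagatorsII, (2.1) p.224] -/
theorem eq_of_mem_cube_zero_translate {L : ℕ} (a : Site d) (M : ℕ) {ρ k P : ℕ} {q : ℤ} (hq : (L : ℤ) ^ k * q = P)
    (hP : L ^ k * M + 2 * (ρ * gs L k) ≤ P) {v w : Site d} {x : Site d}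
    (hv : x ∈ cube L (a + q • v) M ρ k 0) (hw : x ∈ cube L (a + q • w) M ρ k 0) : v = w := by
  rw [cube_eq (Nat.zero_le k)] at hv hw
  simp only [pow_zero, one_mul, Nat.sub_zero, Set.mem_setOf_eq] at hv hw
  have hPz : ((L ^ k * M + 2 * (ρ * gs L k) : ℕ) : ℤ) ≤ (P : ℤ) := by exact_mod_cast hP
  push_cast at hPz
  funext i
  obtain ⟨hv1, hv2⟩ := hv i
  obtain ⟨hw1, hw2⟩ := hw i
  simp only [bLo, bHi, Pi.add_apply, Pi.smul_apply, smul_eq_mul] at hv1 hv2 hw1 hw2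
  push_cast at hv1 hv2 hw1 hw2
  have ev : (L : ℤ) ^ k * (a i + q * v i) = (L : ℤ) ^ k * a i + (P : ℤ) * v i := by rw [mul_add, ← mul_assoc, hq]
  have ev' : (L : ℤ) ^ k * (a i + q * v i + (M : ℤ)) = (L : ℤ) ^ k * a i + (P : ℤ) * v i + (L : ℤ) ^ k * M := by rw [mul_add, ev]
  have ew : (L : ℤ) ^ k * (a i + q * w i) = (L : ℤ) ^ k * a i + (P : ℤ) * w i := by rw [mul_add, ← mul_assoc, hq]
  have ew' : (L : ℤ) ^ k * (a i + q * w i + (M : ℤ)) = (L : ℤ) ^ k * a i + (P : ℤ) * w i + (L : ℤ) ^ k * M := by rw [mul_add, ew]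
  rw [ev] at hv1
  rw [ev'] at hv2
  rw [ew] at hw1
  rw [ew'] at hw2
  have hP0 : (0 : ℤ) < P := by linarith
  -- `P·v_i ≤ x_i − Lᵏa_i + m₀ ≤ P·w_i + LᵏM − 1 + 2m₀ < P·(w_i + 1)` and symmetrically
  have h1 : (P : ℤ) * v i < (P : ℤ) * (w i + 1) := by linarith
  have h2 : (P : ℤ) * w i < (P : ℤ) * (v i + 1) := by linarith
  have h3 : v i < w i + 1 := lt_of_mul_lt_mul_left h1 hP0.le
  have h4 : w i < v i + 1 := lt_of_mul_lt_mul_left h2 hP0.le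
  omega

/-- **A site of `□₀(a + q•v)` lies in no cube of any OTHER translate.** [cite: Balaban1985RegularSpaces, p.98, (1.131) p.99; Balaban1984PropagatorsII, (2.1) p.224] -/
theorem not_mem_cube_translate_of_mem_cube_zero {L : ℕ} (a : Site d) (M : ℕ) {ρ k P : ℕ} {q : ℤ} (hq : (L : ℤ) ^ k * q = P)
    (hP : L ^ k * M + 2 * (ρ * gs L k) ≤ P) {v w : Site d} {x : Site d} (hv : x ∈ cube L (a + q • v) M ρ k 0) (hvw : v ≠ w)
    {j : ℕ} (hjk : j ≤ k) : x ∉ cube L (a + q • w) M ρ k j :=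
  fun h => hvw (eq_of_mem_cube_zero_translate a M hq hP hv (cube_anti (Nat.zero_le j) hjk h))

/-- ★ **A SITE ADJACENT TO `□₀(a + q•v)` FROM OUTSIDE LIES IN NO TRANSLATE'S `□₁`**: if `z ∈ □₀(a + q•v)`, `|t|_∞ ≤ 1` and `z + t ∉ □₀(a + q•v)`, then
`z + t ∉ □₁(a + q•w)` for every `w` — for `w = v` because `□₁ ⊂ □₀`, for `w ≠ v` because `□₁(a + q•w)` keeps the collar `ρ ≥ 1` inside `□₀(a + q•w)`, which
is disjoint from `□₀(a + q•v)`. [cite: Balaban1985RegularSpaces, p.98 («a distance between boundaries of these cubes is equal to R₁M₁Lʲη»), (1.131) p.99] -/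
theorem not_mem_cube_one_translate_of_adj {L : ℕ} (a : Site d) (M : ℕ) {ρ k P : ℕ} {q : ℤ} (hq : (L : ℤ) ^ k * q = P)
    (hP : L ^ k * M + 2 * (ρ * gs L k) ≤ P) (hρ : 1 ≤ ρ) (hk : 1 ≤ k) {v : Site d} {z t : Site d}
    (hz : z ∈ cube L (a + q • v) M ρ k 0) (ht : ∀ i, |t i| ≤ 1) (hzt : z + t ∉ cube L (a + q • v) M ρ k 0) (w : Site d) :
    z + t ∉ cube L (a + q • w) M ρ k 1 := by
  intro h
  -- `z = (z + t) − t ∈ □₀(a + q•w)` by the collar, hence `w = v`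
  have hw0 : z + t + (-t) ∈ cube L (a + q • w) M ρ k 0 :=
    near_mem_cube_zero hρ hk h (-t) fun i => by rw [Pi.neg_apply, abs_neg]; exact ht i
  rw [add_neg_cancel_right] at hw0
  have hvw : v = w := eq_of_mem_cube_zero_translate a M hq hP hz hw0
  subst hvw
  exact hzt (cube_anti (Nat.zero_le 1) hk h)

/-- **The ends of an OFF-`□₀` side of a plaquette touching `□₀(a + q•v)` lie in no translate's `□₁`** (both ends are sup-adjacent to a corner in `□₀(a + q•v)`,
`B8LayerAxialGauge.exists_corner_of_sideTouches`). [cite: Balaban1985RegularSpaces, p.77 (touching convention), p.98, (1.131) p.99] -/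
theorem ends_not_mem_cube_one_of_sideTouches {L : ℕ} (a : Site d) (M : ℕ) {ρ k P : ℕ} {q : ℤ} (hq : (L : ℤ) ^ k * q = P)
    (hP : L ^ k * M + 2 * (ρ * gs L k) ≤ P) (hρ : 1 ≤ ρ) (hk : 1 ≤ k) {v : Site d} {y : Site d} {τ : Fin d}
    (hs : SideTouches (cube L (a + q • v) M ρ k 0) y τ) (hb : ¬ BondTouches (cube L (a + q • v) M ρ k 0) y τ) (w : Site d) :
    y ∉ cube L (a + q • w) M ρ k 1 ∧ y + e τ ∉ cube L (a + q • w) M ρ k 1 := by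
  obtain ⟨σ, hστ, c, hc, hoff, hσ, hτ⟩ := B8LayerAxialGauge.exists_corner_of_sideTouches hs
  have hy : y = c + (y - c) := by abel
  have hy' : y + e τ = c + (y + e τ - c) := by abel
  constructor
  · rw [hy]
    refine not_mem_cube_one_translate_of_adj a M hq hP hρ hk hc (fun i => ?_) (by rw [← hy]; exact fun h => hb (Or.inl h)) w
    rw [Pi.sub_apply, abs_le]
    by_cases h1 : i = σ
    · subst h1; constructor <;> linarith [hσ.1, hσ.2]
    · by_cases h2 : i = τ
      · subst h2; constructor <;> linarith [hτ.1, hτ.2]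
      · rw [hoff i h1 h2]; simp
  · rw [hy']
    refine not_mem_cube_one_translate_of_adj a M hq hP hρ hk hc (fun i => ?_) (by rw [← hy']; exact fun h => hb (Or.inr h)) w
    rw [Pi.sub_apply, Pi.add_apply, e_apply, abs_le]
    by_cases h1 : i = σ
    · subst h1; rw [if_neg hστ]; constructor <;> linarith [hσ.1, hσ.2]
    · by_cases h2 : i = τ
      · subst h2; rw [if_pos rfl]; constructor <;> linarith [hτ.1, hτ.2]
      · rw [hoff i h1 h2, if_neg h2]; simp

end Separation

/-! ## §3 Print's level sets `Lam` ([B11] (3)) of the periodised tower -/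

section Lam

/-- `y ∈ Lam L Ω k j` READS `Ω` AT THE BLOCK CORNER `Lʲ•y` ONLY: `Lʲ•y ∈ Ω_j` and, below the top, `Lʲ•y ∉ Ω_{j+1}` ((1.5) under (1.4)).
[cite: Balaban1985RegularSpaces, (1.5)–(1.6) p.77; Balaban1985Variational, (3) p.278] -/
theorem mem_lamK_iff (L : ℕ) (Ω : ℕ → Set (Site d)) (k j : ℕ) (y : Site d) :
    y ∈ B11Eq7Convention.Lam L Ω k j ↔ ((L : ℤ) ^ j) • y ∈ Ω j ∧ (j < k → ((L : ℤ) ^ j) • y ∉ Ω (j + 1)) := by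
  simp only [B11Eq7Convention.Lam, Set.mem_setOf_eq, B8Ineq132.layer, loK_eq_smul]

/-- ★ **LEVEL `0` OF THE PERIODISED TOWER: `Lam L Ωᴾ k 0 = (⋃_w □₁(a + q•w))ᶜ`** (print's `Λ′₀ = T ∖ □₁` on the cover; `k ≥ 1`).
[cite: Balaban1985RegularSpaces, (1.131) p.99 («Λ′₀ = T ∖ □₁»), (1.5) p.77; Balaban1984PropagatorsII, (2.1) p.224] -/
theorem mem_lam_periodize_zero_iff {L : ℕ} (a : Site d) (M ρ : ℕ) {k P : ℕ} {q : ℤ} (hq : (L : ℤ) ^ k * q = P) (hk : 1 ≤ k) (y : Site d) :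
    y ∈ B11Eq7Convention.Lam L (periodize (fun _ : Fin d => P) (cubeFam true L a M ρ k)) k 0 ↔ ∀ w : Site d, y ∉ cube L (a + q • w) M ρ k 1 := by
  rw [mem_lamK_iff, pow_zero, one_smul, periodize_cubeFam_true_zero, Nat.zero_add, mem_periodize_cubeFam_true_iff a M ρ hq le_rfl hk]
  simp only [Set.mem_univ, true_and, not_exists]
  exact ⟨fun h => h (by omega), fun h _ => h⟩

/-- ★★ **LOCAL AGREEMENT OF THE LEVEL SETS**: for the label `y = blockMap (Lʲ) x` of the level-`j` block of a site `x ∈ □₀(a + q•v)` (`1 ≤ j ≤ k`), membership in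
print's level set of the PERIODISED tower is membership in the level set of the SINGLE tower over `a + q•v` — `Lam` reads `Ω` at the corner, the cubes are block
saturated («□_j is a sum of the big blocks»), and a translate cube containing `x` is the one over `a + q•v` (§2).
[cite: Balaban1985RegularSpaces, (1.5) p.77, p.98 («for every j the cube □_j is a sum of the big blocks of the lattice T_{L^{−j}}»), (1.131) p.99; Balaban1985Variational, (3) p.278] -/
theorem mem_lam_periodize_iff_translate {L : ℕ} (hL : 1 ≤ L) (a : Site d) (M : ℕ) {ρ k P : ℕ} {q : ℤ} (hq : (L : ℤ) ^ k * q = P)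
    (hP : L ^ k * M + 2 * (ρ * gs L k) ≤ P) {v x : Site d} (hx : x ∈ cube L (a + q • v) M ρ k 0) {j : ℕ} (hj1 : 1 ≤ j) (hjk : j ≤ k) :
    blockMap (L ^ j) x ∈ B11Eq7Convention.Lam L (periodize (fun _ : Fin d => P) (cubeFam true L a M ρ k)) k j ↔
      blockMap (L ^ j) x ∈ B11Eq7Convention.Lam L (cubeFam true L (a + q • v) M ρ k) k j := by
  -- block saturation: the corner of the `j`-block of `x` lies in `□_j(a + q•w)` ∕ `□_{j+1}(a + q•w)` iff `x` does
  have hA : ∀ w : Site d, ((L : ℤ) ^ j) • blockMap (L ^ j) x ∈ cube L (a + q • w) M ρ k j ↔ x ∈ cube L (a + q • w) M ρ k j := fun w => by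
    rw [smul_mem_cube_iff hL, mem_cube_iff_inBox_blockMap hL]
  have hB : j < k → ∀ w : Site d, ((L : ℤ) ^ j) • blockMap (L ^ j) x ∈ cube L (a + q • w) M ρ k (j + 1) ↔ x ∈ cube L (a + q • w) M ρ k (j + 1) :=
    fun hj w => by rw [smul_mem_cube_succ_iff hL _ M ρ hj, mem_cube_succ_iff_inBox_blockMap hL _ M ρ hj]
  -- separation: a translate cube containing `x ∈ □₀(a + q•v)` is the one over `a + q•v`
  have huniq : ∀ {i : ℕ} (w : Site d), i ≤ k → x ∈ cube L (a + q • w) M ρ k i → w = v := fun w hi h =>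
    eq_of_mem_cube_zero_translate a M hq hP (cube_anti (Nat.zero_le _) hi h) hx
  rw [mem_lamK_iff, mem_lamK_iff, cubeFam_of_pos true L _ M ρ hj1 hjk]
  refine and_congr ?_ (imp_congr_right fun hj => not_congr ?_)
  · rw [mem_periodize_cubeFam_true_iff a M ρ hq hj1 hjk, hA v]
    constructor
    · rintro ⟨w, hw⟩
      rw [hA w] at hw
      exact (huniq w hjk hw) ▸ hw
    · exact fun h => ⟨v, (hA v).2 h⟩
  · rw [cubeFam_of_pos true L _ M ρ (Nat.succ_pos j) (Nat.succ_le_of_lt hj),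
      mem_periodize_cubeFam_true_iff a M ρ hq (Nat.succ_pos j) (Nat.succ_le_of_lt hj), hB hj v]
    constructor
    · rintro ⟨w, hw⟩
      rw [hB hj w] at hw
      exact (huniq w (Nat.succ_le_of_lt hj) hw) ▸ hw
    · exact fun h => ⟨v, (hB hj v).2 h⟩

/-- ★★ **THE SAME, READ AGAINST dag-n05-c's PINNED FAMILY**: for `x ∈ □₀(a + q•v)`, `1 ≤ j ≤ k`, `L ≤ ρ`: `blockMap (Lʲ) x ∈ Lam L Ωᴾ k j ↔
blockMap (Lʲ) x ∈ cubeLamS L (a + q•v) M ρ k k j` (dag-n05-w2's dictionary `lamK_cubeFam_top_pos`). [cite: Balaban1985RegularSpaces, (1.131) p.99, (1.5) p.77] -/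
theorem mem_lam_periodize_iff_cubeLamS {L : ℕ} (hL : 1 ≤ L) (a : Site d) (M : ℕ) {ρ : ℕ} (hρ : L ≤ ρ) {k P : ℕ} {q : ℤ}
    (hq : (L : ℤ) ^ k * q = P) (hP : L ^ k * M + 2 * (ρ * gs L k) ≤ P) {v x : Site d} (hx : x ∈ cube L (a + q • v) M ρ k 0)
    {j : ℕ} (hj1 : 1 ≤ j) (hjk : j ≤ k) :
    blockMap (L ^ j) x ∈ B11Eq7Convention.Lam L (periodize (fun _ : Fin d => P) (cubeFam true L a M ρ k)) k j ↔
      blockMap (L ^ j) x ∈ cubeLamS L (a + q • v) M ρ k k j := by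
  rw [mem_lam_periodize_iff_translate hL a M hq hP hx hj1 hjk, lamK_cubeFam_top_pos hL _ M hρ hj1 hjk]

/-- **A site of the translate member's family `cubeLamS (a + q•v) … k j` (`1 ≤ j ≤ k`) is a level-`j` site of the periodised tower.**
[cite: Balaban1985RegularSpaces, (1.131) p.99, (1.5) p.77] -/
theorem mem_lam_periodize_of_mem_cubeLamS {L : ℕ} (hL : 1 ≤ L) (a : Site d) (M : ℕ) {ρ : ℕ} (hρ : L ≤ ρ) {k P : ℕ} {q : ℤ}
    (hq : (L : ℤ) ^ k * q = P) (hP : L ^ k * M + 2 * (ρ * gs L k) ≤ P) (v : Site d) {j : ℕ} (hj1 : 1 ≤ j) (hjk : j ≤ k)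
    {z : Site d} (hz : z ∈ cubeLamS L (a + q • v) M ρ k k j) :
    z ∈ B11Eq7Convention.Lam L (periodize (fun _ : Fin d => P) (cubeFam true L a M ρ k)) k j := by
  -- the corner `Lʲ•z ∈ □_j ⊂ □₀` of the block labelled `z`
  have hx : ((L : ℤ) ^ j) • z ∈ cube L (a + q • v) M ρ k 0 :=
    cube_anti (Nat.zero_le j) hjk ((smul_mem_cube_iff hL _ M ρ k j z).2 (inBox_sq_of_mem_cubeLamS hz))
  have h := mem_lam_periodize_iff_cubeLamS hL a M hρ hq hP hx hj1 hjk
  rw [blockMap_pow_smul_self hL] at h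
  exact h.2 hz

end Lam

/-! ## §4 Touching the periodised tower: one translate at a time -/

section Touching

/-- A site of `Ωᴾ_j` (`1 ≤ j ≤ k`) lies in some translate's `□_j`. [cite: Balaban1984PropagatorsII, (2.1) p.224; Balaban1985RegularSpaces, (1.131) p.99] -/
theorem exists_translate_of_mem_periodize {L : ℕ} (a : Site d) (M ρ : ℕ) {k j P : ℕ} {q : ℤ} (hq : (L : ℤ) ^ k * q = P)
    (hj1 : 1 ≤ j) (hjk : j ≤ k) {x : Site d} (hx : x ∈ periodize (fun _ : Fin d => P) (cubeFam true L a M ρ k) j) :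
    ∃ v : Site d, x ∈ cube L (a + q • v) M ρ k j :=
  (mem_periodize_cubeFam_true_iff a M ρ hq hj1 hjk x).1 hx

/-- **A plaquette touching `Ωᴾ_j` (`1 ≤ j ≤ k`) touches some translate's `□_j`.** [cite: Balaban1985RegularSpaces, p.77 (touching convention), (1.131) p.99] -/
theorem exists_translate_of_plaqTouches_periodize {L : ℕ} (a : Site d) (M ρ : ℕ) {k j P : ℕ} {q : ℤ} (hq : (L : ℤ) ^ k * q = P)
    (hj1 : 1 ≤ j) (hjk : j ≤ k) {z : Site d} {κ ν : Fin d} (h : PlaqTouches (periodize (fun _ : Fin d => P) (cubeFam true L a M ρ k) j) z κ ν) :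
    ∃ v : Site d, PlaqTouches (cube L (a + q • v) M ρ k j) z κ ν := by
  rcases h with h | h | h | h
  · obtain ⟨v, hv⟩ := exists_translate_of_mem_periodize a M ρ hq hj1 hjk h; exact ⟨v, Or.inl hv⟩
  · obtain ⟨v, hv⟩ := exists_translate_of_mem_periodize a M ρ hq hj1 hjk h; exact ⟨v, Or.inr (Or.inl hv)⟩
  · obtain ⟨v, hv⟩ := exists_translate_of_mem_periodize a M ρ hq hj1 hjk h; exact ⟨v, Or.inr (Or.inr (Or.inl hv))⟩
  · obtain ⟨v, hv⟩ := exists_translate_of_mem_periodize a M ρ hq hj1 hjk h; exact ⟨v, Or.inr (Or.inr (Or.inr hv))⟩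

/-- **A bond touching `Ωᴾ_j` (`1 ≤ j ≤ k`) touches some translate's `□_j`.** [cite: Balaban1985RegularSpaces, p.77 (touching convention), (1.131) p.99] -/
theorem exists_translate_of_bondTouches_periodize {L : ℕ} (a : Site d) (M ρ : ℕ) {k j P : ℕ} {q : ℤ} (hq : (L : ℤ) ^ k * q = P)
    (hj1 : 1 ≤ j) (hjk : j ≤ k) {y : Site d} {τ : Fin d} (h : BondTouches (periodize (fun _ : Fin d => P) (cubeFam true L a M ρ k) j) y τ) :
    ∃ v : Site d, BondTouches (cube L (a + q • v) M ρ k j) y τ := by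
  rcases h with h | h
  · obtain ⟨v, hv⟩ := exists_translate_of_mem_periodize a M ρ hq hj1 hjk h; exact ⟨v, Or.inl hv⟩
  · obtain ⟨v, hv⟩ := exists_translate_of_mem_periodize a M ρ hq hj1 hjk h; exact ⟨v, Or.inr hv⟩

/-- ★ **A side of a plaquette touching `Ωᴾ_j` (`1 ≤ j ≤ k`) is a side of a plaquette touching some translate's `□_j`.**
[cite: Balaban1985RegularSpaces, p.77 (touching convention), (1.2) p.76, (1.131) p.99] -/
theorem exists_translate_of_sideTouches_periodize {L : ℕ} (a : Site d) (M ρ : ℕ) {k j P : ℕ} {q : ℤ} (hq : (L : ℤ) ^ k * q = P)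
    (hj1 : 1 ≤ j) (hjk : j ≤ k) {y : Site d} {τ : Fin d} (h : SideTouches (periodize (fun _ : Fin d => P) (cubeFam true L a M ρ k) j) y τ) :
    ∃ v : Site d, SideTouches (cube L (a + q • v) M ρ k j) y τ := by
  obtain ⟨z, κ, ν, hκν, hp, hs⟩ := h
  obtain ⟨v, hv⟩ := exists_translate_of_plaqTouches_periodize a M ρ hq hj1 hjk hp
  exact ⟨v, z, κ, ν, hκν, hv, hs⟩

/-- Conversely, touching a translate's `□_j` is touching `Ωᴾ_j` (`1 ≤ j ≤ k`): bonds. [cite: Balaban1985RegularSpaces, p.77 (touching convention)] -/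
theorem bondTouches_periodize_of_translate {L : ℕ} (a : Site d) (M ρ : ℕ) {k j P : ℕ} {q : ℤ} (hq : (L : ℤ) ^ k * q = P)
    (hj1 : 1 ≤ j) (hjk : j ≤ k) (v : Site d) {y : Site d} {τ : Fin d} (h : BondTouches (cube L (a + q • v) M ρ k j) y τ) :
    BondTouches (periodize (fun _ : Fin d => P) (cubeFam true L a M ρ k) j) y τ := by
  rcases h with h | h
  · exact Or.inl (cube_translate_subset_periodize a M ρ hq hj1 hjk v h)
  · exact Or.inr (cube_translate_subset_periodize a M ρ hq hj1 hjk v h)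

/-- Conversely, touching a translate's `□_j` is touching `Ωᴾ_j` (`1 ≤ j ≤ k`): plaquettes. [cite: Balaban1985RegularSpaces, p.77 (touching convention)] -/
theorem plaqTouches_periodize_of_translate {L : ℕ} (a : Site d) (M ρ : ℕ) {k j P : ℕ} {q : ℤ} (hq : (L : ℤ) ^ k * q = P)
    (hj1 : 1 ≤ j) (hjk : j ≤ k) (v : Site d) {z : Site d} {κ ν : Fin d} (h : PlaqTouches (cube L (a + q • v) M ρ k j) z κ ν) :
    PlaqTouches (periodize (fun _ : Fin d => P) (cubeFam true L a M ρ k) j) z κ ν := by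
  have hS := cube_translate_subset_periodize a M ρ hq hj1 hjk v (L := L)
  rcases h with h | h | h | h
  exacts [Or.inl (hS h), Or.inr (Or.inl (hS h)), Or.inr (Or.inr (Or.inl (hS h))), Or.inr (Or.inr (Or.inr (hS h)))]

/-- Conversely, touching a translate's `□_j` is touching `Ωᴾ_j` (`1 ≤ j ≤ k`): sides. [cite: Balaban1985RegularSpaces, p.77 (touching convention), (1.2) p.76] -/
theorem sideTouches_periodize_of_translate {L : ℕ} (a : Site d) (M ρ : ℕ) {k j P : ℕ} {q : ℤ} (hq : (L : ℤ) ^ k * q = P)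
    (hj1 : 1 ≤ j) (hjk : j ≤ k) (v : Site d) {y : Site d} {τ : Fin d} (h : SideTouches (cube L (a + q • v) M ρ k j) y τ) :
    SideTouches (periodize (fun _ : Fin d => P) (cubeFam true L a M ρ k) j) y τ := by
  obtain ⟨z, κ, ν, hκν, hp, hs⟩ := h
  exact ⟨z, κ, ν, hκν, plaqTouches_periodize_of_translate a M ρ hq hj1 hjk v hp, hs⟩

end Touching

end Literature.MathematicalPhysics.QuantumFieldTheory.Balaban1983to89.B8Ineq159PeriodizedTowerReads

end
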